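import Summits.QuantumFields.YangMills.Theorems.SwapVirialDeficitConeMeasureHubCot
import Summits.QuantumFields.YangMills.Theorems.SwapVirialDeficitSectorLaplaceBulkIntegrated
import Summits.QuantumFields.YangMills.Theorems.SwapVirialDeficitSectorLaplaceMainConstFloor
import Summits.QuantumFields.YangMills.Theorems.WeakCouplingRatesColdBoxCubic
import HarnessLib

/-!
# The hub letters in `δ = cot ψ = re a ∕ ‖Im a‖`: `hubS1 = 4δ²∕(1+δ²)²`, `hubS2 = (1+δ²)⁻¹`, and an EXPLICIT FLOOR of the cone mass of the bulk hubs
# `coneMeasure (HubBulk τ) ≥ coneConst·π∕16` for `0 < τ ≤ 1∕2`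
# (free-hands support of ⟨stmt-QuantumFields-24197⟩ `SwapVirialDeficit.SwapGluedStiffness` ∕ ⟨24194⟩; cell ym-idea-1, skeleton ➎ (S-bulk): the region-local floor of
# `mbHubBulk` needs a NUMBER for the cone mass of `HubBulk τ` — g47 19:15Z «✓mbDensity_ge × cone(HubBulk τ) ≥ cone(HubBulk ½) > 0»)

With ✓`lintegral_coneMeasure_hubCot` (`∫ G(δ(a)) dcone = coneConst·π·∫ G(δ)((1+δ²)⁻¹)² dδ`) every hub set described by `hubS1 = sin²2ψ`, `hubS2 = sin²ψ` is a `δ`-set: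
* §1 ★ `hubS2_eq_cot (him) : hubS2 a = (1 + δ²)⁻¹`, ★ `hubS1_eq_cot (him) : hubS1 a = 4δ²∕(1+δ²)²` (`δ = a.re∕‖a.im‖`);
* §2 `mem_hubBulk_of_cot` — `a.im ≠ 0`, `9∕16 ≤ δ² ≤ 1`, `τ ≤ 1∕2` ⟹ `a ∈ HubBulk τ`;
* §3 ★★ `coneMeasure_hubBulk_ge (hτ : 0 < τ) (hτ2 : τ ≤ 1∕2) : ENNReal.ofReal (coneConst * π ∕ 16) ≤ coneMeasure (HubBulk τ)` (the window `δ ∈ [3∕4, 1]`, weight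
  `((1+δ²)⁻¹)² ≥ 1∕4` there; cone-a.e. `a.im ≠ 0` by ✓`ae_re_ne_zero_im_ne_zero_coneMeasure`).

HONEST LABEL: elementary; region stubs, ⟨24197⟩ ∕ ⟨24194⟩ OPEN; own crux ⟨22884⟩ OPEN (blocked-on ⟨19935⟩); the Yang–Mills mass gap is NOT proved; no summit is proved by a line.
THEOREMS ONLY (0 `def`, 0 `sorry`; the series' local `ℍ` instances), standard axioms.  Width seat ym-line-sfw-p2-w2 g59 (cell ym-idea-1, free hands),
`--supports stmt-QuantumFields-24197`.  References: [folklore]; [cite: tHooft1979].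
-/

set_option autoImplicit false

noncomputable section

open MeasureTheory Quaternion Set
open scoped Quaternion ENNReal BigOperators
open Literature.MathematicalPhysics.QuantumLattice
open Literature.MathematicalPhysics.QuantumFieldTheory hiding SU2
open Summit.QuantumFields.YangMills.Theorems.SwapTwistDeficit.ToronLog

attribute [local instance] Literature.Analysis.FluidPDE.Tao2016.quatMeasurableSpace
  Literature.Analysis.FluidPDE.Tao2016.quatBorelSpace
  Literature.MathematicalPhysics.QuantumLattice.secondCountableTopology_su2

namespace Summit.QuantumFields.YangMills.Theorems.SwapVirialDeficit.SectorLaplace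

open Summit.QuantumFields.YangMills.Theorems.SwapVirialDeficit.BlowUpRing

/-! ## §1 The hub stiffnesses in the letter `δ` -/

/-- ★ `hubS2 a = sin²ψ = (1 + δ²)⁻¹`, `δ = re a ∕ ‖Im a‖` (`Im a ≠ 0`). [folklore] -/
theorem hubS2_eq_cot {a : ℍ} (him : a.im ≠ 0) : hubS2 a = (1 + (a.re / ‖a.im‖) ^ 2)⁻¹ := by
  have hi : 0 < ‖a.im‖ := norm_pos_iff.2 him
  have hn2 : ‖a‖ ^ 2 = a.re ^ 2 + ‖a.im‖ ^ 2 := by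
    have h1 : ‖a‖ ^ 2 = Quaternion.normSq a := by rw [Quaternion.normSq_eq_norm_mul_self, sq]
    rw [h1, Quaternion.normSq_def', WeakCouplingRates.sq_norm_im]; ring
  have hpos : 0 < a.re ^ 2 + ‖a.im‖ ^ 2 := by positivity
  unfold hubS2
  rw [mul_pow, inv_pow, hn2]
  field_simp
  ring

/-- ★ `hubS1 a = sin²2ψ = 4δ²∕(1 + δ²)²`, `δ = re a ∕ ‖Im a‖` (`Im a ≠ 0`). [folklore] -/
theorem hubS1_eq_cot {a : ℍ} (him : a.im ≠ 0) : hubS1 a = 4 * (a.re / ‖a.im‖) ^ 2 / (1 + (a.re / ‖a.im‖) ^ 2) ^ 2 := by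
  have hi : 0 < ‖a.im‖ := norm_pos_iff.2 him
  have hn2 : ‖a‖ ^ 2 = a.re ^ 2 + ‖a.im‖ ^ 2 := by
    have h1 : ‖a‖ ^ 2 = Quaternion.normSq a := by rw [Quaternion.normSq_eq_norm_mul_self, sq]
    rw [h1, Quaternion.normSq_def', WeakCouplingRates.sq_norm_im]; ring
  have hpos : 0 < a.re ^ 2 + ‖a.im‖ ^ 2 := by positivity
  unfold hubS1
  have e : (2 * (‖a‖⁻¹ * a.re) * (‖a‖⁻¹ * ‖a.im‖)) ^ 2 = 4 * a.re ^ 2 * ‖a.im‖ ^ 2 * ((‖a‖ ^ 2)⁻¹) ^ 2 := by ring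
  rw [e, hn2]
  field_simp
  ring

/-! ## §2 A window of bulk hubs -/

/-- For `τ ≤ 1∕2`: every hub with `Im a ≠ 0` and `9∕16 ≤ δ² ≤ 1` is a bulk hub (`hubS2 ≥ 1∕2`, `hubS1 ≥ 9∕16`). [folklore] -/
theorem mem_hubBulk_of_cot {a : ℍ} (him : a.im ≠ 0) {τ : ℝ} (hτ2 : τ ≤ 1 / 2) (h1 : 9 / 16 ≤ (a.re / ‖a.im‖) ^ 2) (h2 : (a.re / ‖a.im‖) ^ 2 ≤ 1) :
    a ∈ HubBulk τ := by
  have ha : a ≠ 0 := fun h => him (by rw [h]; rfl)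
  set d : ℝ := (a.re / ‖a.im‖) ^ 2 with hd
  have hd0 : 0 ≤ d := sq_nonneg _
  refine ⟨ha, ?_, ?_⟩
  · rw [hubS1_eq_cot him, ← hd, le_div_iff₀ (by positivity)]
    have h3 : (1 + d) ^ 2 ≤ 4 := by nlinarith
    have h4 : τ * (1 + d) ^ 2 ≤ 1 / 2 * 4 := mul_le_mul hτ2 h3 (sq_nonneg _) (by norm_num)
    linarith
  · rw [hubS2_eq_cot him, ← hd]
    have h3 : (2 : ℝ)⁻¹ ≤ (1 + d)⁻¹ := by rw [inv_le_inv₀ (by norm_num) (by positivity)]; linarith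
    linarith

/-! ## §3 The cone mass of the bulk hubs, explicitly -/

/-- ★★ **AN EXPLICIT FLOOR OF THE CONE MASS OF THE BULK HUBS**: for `0 < τ ≤ 1∕2`, `coneConst·π∕16 ≤ coneMeasure (HubBulk τ)` (the window `δ ∈ [3∕4, 1]` of
✓`mem_hubBulk_of_cot`, where the weight `((1+δ²)⁻¹)²` is `≥ 1∕4`; ✓`lintegral_coneMeasure_hubCot`). [folklore] -/
theorem coneMeasure_hubBulk_ge {τ : ℝ} (hτ2 : τ ≤ 1 / 2) : ENNReal.ofReal (coneConst * Real.pi / 16) ≤ coneMeasure (HubBulk τ) := by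
  -- the window indicator in the letter `δ`
  set G : ℝ → ℝ≥0∞ := (Icc (3 / 4 : ℝ) 1).indicator fun _ => (1 : ℝ≥0∞) with hG
  have hGm : Measurable G := measurable_const.indicator measurableSet_Icc
  -- a.e. comparison with the indicator of the bulk hubs
  have hle : ∀ᵐ a : ℍ ∂coneMeasure, G (a.re / ‖a.im‖) ≤ (HubBulk τ).indicator 1 a := by
    filter_upwards [ae_re_ne_zero_im_ne_zero_coneMeasure] with a ha
    by_cases hδ : a.re / ‖a.im‖ ∈ Icc (3 / 4 : ℝ) 1
    · have hmem : a ∈ HubBulk τ := by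
        refine mem_hubBulk_of_cot ha.2 hτ2 ?_ ?_
        · nlinarith [hδ.1, hδ.2]
        · nlinarith [hδ.1, hδ.2]
      rw [hG, indicator_of_mem hδ, indicator_of_mem hmem, Pi.one_apply]
    · rw [hG, indicator_of_notMem hδ]; exact zero_le
  have h1 : ∫⁻ a, G (a.re / ‖a.im‖) ∂coneMeasure ≤ coneMeasure (HubBulk τ) := by
    rw [← lintegral_indicator_one (measurableSet_hubBulk τ)]
    exact lintegral_mono_ae hle
  refine le_trans ?_ h1
  rw [lintegral_coneMeasure_hubCot G hGm]
  -- the `δ`-integral is at least `(1∕4)·(1∕4)`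
  have hw : ∀ δ : ℝ, (Icc (3 / 4 : ℝ) 1).indicator (fun _ => ENNReal.ofReal (1 / 4)) δ ≤ G δ * ENNReal.ofReal (((1 + δ ^ 2)⁻¹) ^ 2) := by
    intro δ
    by_cases hδ : δ ∈ Icc (3 / 4 : ℝ) 1
    · rw [indicator_of_mem hδ, hG, indicator_of_mem hδ, one_mul]
      apply ENNReal.ofReal_le_ofReal
      have hd : 1 + δ ^ 2 ≤ 2 := by nlinarith [hδ.1, hδ.2]
      have hinv : (2 : ℝ)⁻¹ ≤ (1 + δ ^ 2)⁻¹ := by rw [inv_le_inv₀ (by norm_num) (by positivity)]; exact hd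
      nlinarith [hinv, inv_nonneg.2 (by positivity : (0 : ℝ) ≤ 1 + δ ^ 2)]
    · rw [indicator_of_notMem hδ]; exact zero_le
  have h2 : ENNReal.ofReal (1 / 4) * ENNReal.ofReal (1 / 4) ≤ ∫⁻ δ, G δ * ENNReal.ofReal (((1 + δ ^ 2)⁻¹) ^ 2) := by
    calc ENNReal.ofReal (1 / 4) * ENNReal.ofReal (1 / 4) = ENNReal.ofReal (1 / 4) * volume (Icc (3 / 4 : ℝ) 1) := by
          rw [Real.volume_Icc]; norm_num
      _ = ∫⁻ δ, (Icc (3 / 4 : ℝ) 1).indicator (fun _ => ENNReal.ofReal (1 / 4)) δ := (lintegral_indicator_const measurableSet_Icc _).symm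
      _ ≤ _ := lintegral_mono hw
  calc ENNReal.ofReal (coneConst * Real.pi / 16) = ENNReal.ofReal (coneConst * Real.pi) * (ENNReal.ofReal (1 / 4) * ENNReal.ofReal (1 / 4)) := by
        rw [← ENNReal.ofReal_mul (by norm_num), ← ENNReal.ofReal_mul (mul_nonneg coneConst_pos.le Real.pi_pos.le)]
        congr 1; ring
    _ ≤ ENNReal.ofReal (coneConst * Real.pi) * ∫⁻ δ, G δ * ENNReal.ofReal (((1 + δ ^ 2)⁻¹) ^ 2) := by gcongr

end Summit.QuantumFields.YangMills.Theorems.SwapVirialDeficit.SectorLaplace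

end
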